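import Mathlib.LinearAlgebra.Matrix.Notation
import Mathlib.Data.Matrix.Basic
import Mathlib.Tactic.Ring
import Mathlib.Tactic.FieldSimp
import Mathlib.Tactic.LinearCombination
import HarnessLib
import Summits.Ventures.HSemireg.FactorModuleBlock

/-!
# Venture HSemireg — the CLOSED FORM of the secant structure `𝒥_v` (ENGINE-W PROBE5 §1) on one factor of weight `c`: with node `λ = α + β·l`
# (`β ≠ 0`, `l² = m`) and `F = c·[[0,−1],[1,0]]`, the 4×4 block `𝒥 = [[−(α∕β)I, −(1∕β)F⁻¹],[((α²−β²m)∕β)F, (α∕β)I]]` satisfies `𝒥² = m·1` and is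
# `Q`-skew for the hyperbolic pairing `Q = [[0,I],[I,0]]` — over any field, as polynomial∕rational identities; the integral specialisation
# `λ′ = (A + l)∕N` recovers the block of `FactorModuleBlock.lean` — kernel algebra

HONEST FRAMING. Lean index of the computation cell `pub-hsemireg`, widening group ENGINE-W (code A, seat `engine-w-1`, gen 18).
MATRIX IDENTITIES ONLY; the derivation of the closed form from the two graphs `N_i = {(d, −λ_i F d)}` («𝒥 = l(P₁ − P₂)») is NOT formalised, nor is
anything object-level; nothing here says that HC, HC_CM or HC_AV holds. Theorems only (0 `def`, 0 named fact, 0 `sorry`). New namespace `SecantForm`; imports `FactorModuleBlock.lean` (landed k = 436) for the block identity.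
Companions: `FactorModuleBlock.lean` (#34, integral blocks; PRECISION P-22-1), `MixingTransportCertificates.lean` (#39), `R1ZTypeShadow.lean` (#41).

SOURCE (the cell's own result, by value): `widen/ENGINE-W/out/probe5/PROBE5-STIZ-A.md` §1 «𝒥_v = [[ −(α∕β)·I , −(1∕β)·F_h⁻¹ ], [ ((α² − β²m)∕β)·F_h ,
(α∕β)·I ]], F_h = φ_h: d ↦ ι_d h (F[2a+1][2a] = c_a, F[2a][2a+1] = −c_a) … It is Q-skew (𝒥 ∈ so(U_ℚ)), 𝒥² = m, and it depends on (λ, h) only».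
On one factor `F = [[0,−c],[c,0]]`, `F⁻¹ = [[0,1∕c],[−1∕c,0]]`, so in the basis `(d_x, d_y | x, y)`:
`𝒥 = [[−a, 0, 0, −u∕c],[0, −a, u∕c, 0],[0, −w·c, a, 0],[w·c, 0, 0, a]]` with `a = α∕β`, `u = 1∕β`, `w = (α² − β²m)∕β`. What the kernel holds:

* (cited, not restated) `FactorBlock.block_sq` of `FactorModuleBlock.lean` — for ANY `a, u′, w′` in a commutative ring:
  `[[−a,0,0,−u′],[0,−a,u′,0],[0,−w′,a,0],[w′,0,0,a]]² = (a² − u′w′)·1` (the structure constant is `a² − u′·w′`); used below via `rw`.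
* `closed_form_sq` — over a field with `β ≠ 0`, `c ≠ 0`: with `a = α∕β`, `u′ = (1∕β)∕c`, `w′ = ((α² − β²m)∕β)·c` one has `a² − u′w′ = m`, hence
  `𝒥² = m·1` («𝒥² = m»).
* `Q_skew` — `𝒥ᵀ·Q + Q·𝒥 = 0` for `Q = [[0,0,1,0],[0,0,0,1],[1,0,0,0],[0,1,0,0]]` and every block of the displayed shape («𝒥 ∈ so(U_ℚ)»).
* `integral_specialisation` — at `λ′ = (A + l)∕N` (`α = A∕N`, `β = 1∕N`): `a = A`, `1∕β = N`, `(α² − β²m)∕β = (A² − m)∕N = t`; so the block is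
  `[[−A,0,0,−N∕c],[0,−A,N∕c,0],[0,−tc,A,0],[tc,0,0,A]]`, the one of `FactorModuleBlock.block_sq_eq` (field identities, `N ≠ 0`).
* (cited, not restated) the split seed `λ = l` (`α = 0`, `β = 1`, `c = 1`): `𝒥_s = [[0,0,0,−1],[0,0,1,0],[0,m,0,0],[−m,0,0,0]]` squares to `m·1` —
  this is exactly `FactorBlock.seed_block_sq` of `FactorModuleBlock.lean` (v2 of this file, 2026-08-26: the two restating copies were removed
  per the gate's `dedup.landed`; statements and proofs of the four remaining theorems are byte-identical to v1).
-/

namespace Summit.Ventures.HSemireg.SecantForm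

open Matrix

/-- **«𝒥² = m»** for the closed form: over a field, with `β ≠ 0`, `c ≠ 0`, `a = α∕β`, `u = (1∕β)∕c`, `w = ((α² − β²·m)∕β)·c`:
`a² − u·w = m`. [kernel, `field_simp` + `ring`] -/
theorem structure_constant {K : Type*} [Field K] (α β m c : K) (hβ : β ≠ 0) (hc : c ≠ 0) :
    (α / β) ^ 2 - ((1 / β) / c) * (((α ^ 2 - β ^ 2 * m) / β) * c) = m := by
  field_simp
  ring

/-- Hence the closed-form block squares to `m·1`. [kernel] -/
theorem closed_form_sq {K : Type*} [Field K] (α β m c : K) (hβ : β ≠ 0) (hc : c ≠ 0) :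
    !![-(α / β), 0, 0, -((1 / β) / c); 0, -(α / β), (1 / β) / c, 0; 0, -(((α ^ 2 - β ^ 2 * m) / β) * c), α / β, 0;
        ((α ^ 2 - β ^ 2 * m) / β) * c, 0, 0, α / β]
      * !![-(α / β), 0, 0, -((1 / β) / c); 0, -(α / β), (1 / β) / c, 0; 0, -(((α ^ 2 - β ^ 2 * m) / β) * c), α / β, 0;
        ((α ^ 2 - β ^ 2 * m) / β) * c, 0, 0, α / β]
      = m • (1 : Matrix (Fin 4) (Fin 4) K) := by
  rw [Summit.Ventures.HSemireg.FactorBlock.block_sq, structure_constant α β m c hβ hc]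

/-- **«𝒥 is Q-skew»**: `𝒥ᵀ·Q + Q·𝒥 = 0` for the hyperbolic pairing `Q = [[0,I],[I,0]]` and every block of the shape
`[[−a,0,0,−u],[0,−a,u,0],[0,−w,a,0],[w,0,0,a]]`. [kernel] -/
theorem Q_skew {R : Type*} [CommRing R] (a u w : R) :
    (!![-a, 0, 0, -u; 0, -a, u, 0; 0, -w, a, 0; w, 0, 0, a])ᵀ * !![(0 : R), 0, 1, 0; 0, 0, 0, 1; 1, 0, 0, 0; 0, 1, 0, 0]
      + !![(0 : R), 0, 1, 0; 0, 0, 0, 1; 1, 0, 0, 0; 0, 1, 0, 0] * !![-a, 0, 0, -u; 0, -a, u, 0; 0, -w, a, 0; w, 0, 0, a] = 0 := by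
  ext i j
  fin_cases i <;> fin_cases j <;> simp [Matrix.mul_apply, Fin.sum_univ_four]

/-- **The integral specialisation** `λ′ = (A + l)∕N`: with `α = A∕N`, `β = 1∕N` (`N ≠ 0`) one has `α∕β = A`, `1∕β = N` and
`(α² − β²m)∕β = (A² − m)∕N` (`= t`). [kernel, `field_simp`] -/
theorem integral_specialisation {K : Type*} [Field K] (A N m : K) (hN : N ≠ 0) :
    (A / N) / (1 / N) = A ∧ 1 / (1 / N) = N ∧ ((A / N) ^ 2 - (1 / N) ^ 2 * m) / (1 / N) = (A ^ 2 - m) / N := by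
  refine ⟨?_, ?_, ?_⟩
  · field_simp
  · field_simp
  · field_simp

end Summit.Ventures.HSemireg.SecantForm
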